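import Mathlib.Analysis.SpecialFunctions.SmoothTransition
import Mathlib.Analysis.InnerProductSpace.Calculus
import Mathlib.Analysis.Calculus.MeanValue
import Mathlib.Analysis.Calculus.Deriv.MeanValue
import Mathlib.Analysis.InnerProductSpace.PiL2
import Literature.Analysis.Calculus.SmoothCutoff
import HarnessLib

/-!
# A `C¹` radial cutoff vector field (helper for stub `stub_activityDomination`, line SketchK1)

Crux `Summit.AtomisticToContinuum.HydrodynamicLimit.Theses.OneFlightGossipEngine.CollisionActivityTails`
(stmt-AtomisticToContinuum-13734), line `SketchK1` (`Cruxes/CollisionActivityTails/Lines/SketchK1.lean`),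
stub `stub_activityDomination : ActivityDomination` — the co-moving localized pair virial. Its test field is
the radial cutoff of the identity built here, on a real inner product space `E`:

`cutoffField ε y = χ_ε(‖y‖) • y`, `χ_ε(r) = Real.smoothTransition ((2ε − r)/ε)`,

so that `χ_ε = 1` on `[0, ε]`, `χ_ε = 0` on `[2ε, ∞)`, `0 ≤ χ_ε ≤ 1`, and `χ_ε` is Lipschitz with constant `D/ε`
(`D` the tree's bound on `|smoothTransition'|`, `Literature.Analysis.Calculus.exists_bound_deriv_smoothTransition`).
Consequences used by the virial argument: `cutoffField ε y = y` for `‖y‖ ≤ ε` (exact value at contact),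
`cutoffField ε y = 0` for `2ε ≤ ‖y‖`, `‖cutoffField ε y‖ ≤ min ‖y‖ 2ε`, `ContDiff ℝ 1 (cutoffField ε)`, the
quadratic-form bound `⟪D(cutoffField ε)(y) h, h⟫ ≥ −2D ‖h‖²` (uniform in `ε`), and the segment bound
`⟪cutoffField ε (a + t • n) − cutoffField ε a, n⟫ ≥ −2D t` for a unit vector `n` and `t ≥ 0`.
The registered helper statement is `CutoffFieldToolkit` (an existential package of these facts).
-/

noncomputable section

open Set Filter Topology
open scoped InnerProductSpace

namespace Summit.AtomisticToContinuum.HydrodynamicLimit.Theorems.CollisionActivityTailsCutoff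

variable {E : Type*} [NormedAddCommGroup E] [InnerProductSpace ℝ E]

/-! ## The scalar profile -/

/-- The radial profile `χ_ε(r) = smoothTransition ((2ε − r)/ε)`: `1` on `r ≤ ε`, `0` on `r ≥ 2ε`. -/
def cutoffProfile (ε r : ℝ) : ℝ := Real.smoothTransition ((2 * ε - r) / ε)

/-- `χ_ε(r) = 1` for `r ≤ ε` (and `ε > 0`). -/
theorem cutoffProfile_eq_one {ε r : ℝ} (hε : 0 < ε) (hr : r ≤ ε) : cutoffProfile ε r = 1 :=
  Real.smoothTransition.one_of_one_le ((one_le_div hε).2 (by linarith))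

/-- `χ_ε(r) = 0` for `2ε ≤ r` (and `ε > 0`). -/
theorem cutoffProfile_eq_zero {ε r : ℝ} (hε : 0 < ε) (hr : 2 * ε ≤ r) : cutoffProfile ε r = 0 :=
  Real.smoothTransition.zero_of_nonpos (div_nonpos_of_nonpos_of_nonneg (by linarith) hε.le)

/-- `0 ≤ χ_ε`. -/
theorem cutoffProfile_nonneg (ε r : ℝ) : 0 ≤ cutoffProfile ε r := Real.smoothTransition.nonneg _

/-- `χ_ε ≤ 1`. -/
theorem cutoffProfile_le_one (ε r : ℝ) : cutoffProfile ε r ≤ 1 := Real.smoothTransition.le_one _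

/-- `χ_ε` is smooth. -/
theorem contDiff_cutoffProfile (ε : ℝ) {n : ℕ∞} : ContDiff ℝ n (cutoffProfile ε) := by
  show ContDiff ℝ n fun r => Real.smoothTransition ((2 * ε - r) / ε)
  exact Real.smoothTransition.contDiff.comp ((contDiff_const.sub contDiff_id).div_const ε)

/-- `χ_ε` is Lipschitz with constant `D/ε`, `D` a bound on `|smoothTransition'|`. -/
theorem lipschitzWith_cutoffProfile {ε D : ℝ} (hε : 0 < ε) (hD0 : 0 ≤ D)
    (hD : ∀ t, |deriv Real.smoothTransition t| ≤ D) :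
    LipschitzWith (Real.toNNReal (D / ε)) (cutoffProfile ε) := by
  have hdiff : Differentiable ℝ (cutoffProfile ε) :=
    (contDiff_cutoffProfile ε (n := 1)).differentiable one_ne_zero
  refine lipschitzWith_of_nnnorm_deriv_le hdiff fun r => ?_
  have hinner : HasDerivAt (fun r : ℝ => (2 * ε - r) / ε) (-ε⁻¹) r :=
    (((hasDerivAt_const r (2 * ε)).sub (hasDerivAt_id r)).div_const ε).congr_deriv (by ring)
  have hcomp : HasDerivAt (cutoffProfile ε)
      (deriv Real.smoothTransition ((2 * ε - r) / ε) * (-ε⁻¹)) r :=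
    (Literature.Analysis.Calculus.differentiable_smoothTransition _).hasDerivAt.comp r hinner
  rw [hcomp.deriv]
  have hval : ‖deriv Real.smoothTransition ((2 * ε - r) / ε) * -ε⁻¹‖ ≤ D / ε := by
    rw [norm_mul, Real.norm_eq_abs, Real.norm_eq_abs, abs_neg, abs_inv, abs_of_pos hε,
      div_eq_mul_inv]
    exact mul_le_mul_of_nonneg_right (hD _) (inv_nonneg.2 hε.le)
  have hDε : 0 ≤ D / ε := div_nonneg hD0 hε.le
  rw [← NNReal.coe_le_coe, coe_nnnorm, Real.coe_toNNReal _ hDε]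
  exact hval

/-! ## The vector field -/

/-- The radial cutoff of the identity: `ζ_ε(y) = χ_ε(‖y‖) y`. -/
def cutoffField (ε : ℝ) (y : E) : E := cutoffProfile ε ‖y‖ • y

/-- On the core `‖y‖ ≤ ε` the field is the identity. -/
theorem cutoffField_eq_self {ε : ℝ} (hε : 0 < ε) {y : E} (hy : ‖y‖ ≤ ε) : cutoffField ε y = y := by
  rw [cutoffField, cutoffProfile_eq_one hε hy, one_smul]

/-- Outside `2ε` the field vanishes. -/
theorem cutoffField_eq_zero {ε : ℝ} (hε : 0 < ε) {y : E} (hy : 2 * ε ≤ ‖y‖) : cutoffField ε y = 0 := by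
  rw [cutoffField, cutoffProfile_eq_zero hε hy, zero_smul]

/-- `‖ζ_ε(y)‖ ≤ ‖y‖`. -/
theorem norm_cutoffField_le (ε : ℝ) (y : E) : ‖cutoffField ε y‖ ≤ ‖y‖ := by
  rw [cutoffField, norm_smul, Real.norm_eq_abs, abs_of_nonneg (cutoffProfile_nonneg _ _)]
  exact mul_le_of_le_one_left (norm_nonneg _) (cutoffProfile_le_one _ _)

/-- `‖ζ_ε(y)‖ ≤ 2ε`. -/
theorem norm_cutoffField_le_two_mul {ε : ℝ} (hε : 0 < ε) (y : E) : ‖cutoffField ε y‖ ≤ 2 * ε := by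
  rcases le_or_gt (2 * ε) ‖y‖ with h | h
  · rw [cutoffField_eq_zero hε h, norm_zero]
    linarith
  · exact (norm_cutoffField_le ε y).trans h.le

/-- The scalar factor `y ↦ χ_ε(‖y‖)` is `C¹`: near the origin it is constant, elsewhere the norm is smooth.
-/
theorem contDiff_cutoffProfile_norm {ε : ℝ} (hε : 0 < ε) :
    ContDiff ℝ 1 fun y : E => cutoffProfile ε ‖y‖ := by
  rw [contDiff_iff_contDiffAt]
  intro y
  by_cases hy : ‖y‖ < ε
  · -- locally constant `= 1`
    have hev : (fun y : E => cutoffProfile ε ‖y‖) =ᶠ[𝓝 y] fun _ => (1 : ℝ) := by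
      have hopen : IsOpen {x : E | ‖x‖ < ε} := isOpen_lt continuous_norm continuous_const
      filter_upwards [hopen.mem_nhds hy] with x hx
      exact cutoffProfile_eq_one hε (le_of_lt hx)
    exact (contDiffAt_const.congr_of_eventuallyEq hev)
  · have hy0 : y ≠ 0 := by
      intro h
      apply hy
      rw [h, norm_zero]
      exact hε
    exact (contDiff_cutoffProfile ε).contDiffAt.comp y (contDiffAt_norm ℝ hy0)

/-- `ζ_ε` is `C¹`. -/
theorem contDiff_cutoffField {ε : ℝ} (hε : 0 < ε) : ContDiff ℝ 1 (cutoffField (E := E) ε) :=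
  (contDiff_cutoffProfile_norm hε).smul contDiff_id

omit [InnerProductSpace ℝ E] in
/-- The scalar factor is Lipschitz with constant `D/ε` (the norm is `1`-Lipschitz). -/
theorem lipschitzWith_cutoffProfile_norm {ε D : ℝ} (hε : 0 < ε) (hD0 : 0 ≤ D)
    (hD : ∀ t, |deriv Real.smoothTransition t| ≤ D) :
    LipschitzWith (Real.toNNReal (D / ε)) fun y : E => cutoffProfile ε ‖y‖ := by
  have h := (lipschitzWith_cutoffProfile hε hD0 hD).comp (lipschitzWith_one_norm (E := E))
  rw [mul_one] at h
  exact h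

/-- **Quadratic-form bound for the derivative**: `⟪Dζ_ε(y) h, h⟫ ≥ −2D ‖h‖²`, uniformly in `ε > 0`
(product rule: `Dζ(y)h = χ(‖y‖) h + (Dχ∘‖·‖)(y)h · y`; the first term is `≥ 0`, the second has operator norm
`≤ (D/ε) · ‖y‖ ≤ 2D` where `χ' ≠ 0`, i.e. for `‖y‖ ≤ 2ε`; beyond `2ε` the field vanishes identically). -/
theorem inner_fderiv_cutoffField_ge {ε D : ℝ} (hε : 0 < ε) (hD0 : 0 ≤ D)
    (hD : ∀ t, |deriv Real.smoothTransition t| ≤ D) (y h : E) :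
    -(2 * D) * ‖h‖ ^ 2 ≤ ⟪fderiv ℝ (cutoffField ε) y h, h⟫_ℝ := by
  rcases le_or_gt ‖y‖ (2 * ε) with hy | hy
  · -- product rule
    set c : E → ℝ := fun y => cutoffProfile ε ‖y‖ with hc
    have hcd : DifferentiableAt ℝ c y := (contDiff_cutoffProfile_norm hε).differentiable one_ne_zero y
    have hprod : HasFDerivAt (cutoffField (E := E) ε)
        (c y • ContinuousLinearMap.id ℝ E + (fderiv ℝ c y).smulRight y) y := by
      have h := hcd.hasFDerivAt.smul (hasFDerivAt_id (𝕜 := ℝ) y)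
      exact h
    rw [hprod.fderiv]
    simp only [_root_.add_apply, _root_.smul_apply, ContinuousLinearMap.id_apply,
      ContinuousLinearMap.smulRight_apply, inner_add_left, inner_smul_left, RCLike.conj_to_real]
    have h1 : 0 ≤ c y * ⟪h, h⟫_ℝ :=
      mul_nonneg (cutoffProfile_nonneg _ _) real_inner_self_nonneg
    have hlip := lipschitzWith_cutoffProfile_norm (E := E) hε hD0 hD
    have hnorm : ‖fderiv ℝ c y‖ ≤ D / ε := by
      have := norm_fderiv_le_of_lipschitz ℝ (x₀ := y) hlip
      rwa [Real.coe_toNNReal _ (div_nonneg hD0 hε.le)] at this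
    have h2 : |fderiv ℝ c y h * ⟪y, h⟫_ℝ| ≤ 2 * D * ‖h‖ ^ 2 := by
      rw [abs_mul]
      calc |fderiv ℝ c y h| * |⟪y, h⟫_ℝ| ≤ (D / ε * ‖h‖) * (‖y‖ * ‖h‖) := by
            refine mul_le_mul ?_ (abs_real_inner_le_norm _ _) (abs_nonneg _) (by positivity)
            calc |fderiv ℝ c y h| = ‖fderiv ℝ c y h‖ := (Real.norm_eq_abs _).symm
              _ ≤ ‖fderiv ℝ c y‖ * ‖h‖ := ContinuousLinearMap.le_opNorm _ _
              _ ≤ D / ε * ‖h‖ := mul_le_mul_of_nonneg_right hnorm (norm_nonneg _)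
        _ ≤ (D / ε * ‖h‖) * (2 * ε * ‖h‖) := by
            refine mul_le_mul_of_nonneg_left (mul_le_mul_of_nonneg_right hy (norm_nonneg _)) ?_
            exact mul_nonneg (div_nonneg hD0 hε.le) (norm_nonneg _)
        _ = 2 * D * ‖h‖ ^ 2 := by
            field_simp
    have h3 := neg_abs_le (fderiv ℝ c y h * ⟪y, h⟫_ℝ)
    rw [real_inner_self_eq_norm_sq] at h1 ⊢
    linarith [h1, h2, h3]
  · -- the field vanishes near `y`
    have hev : cutoffField (E := E) ε =ᶠ[𝓝 y] fun _ => 0 := by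
      have hopen : IsOpen {x : E | 2 * ε < ‖x‖} := isOpen_lt continuous_const continuous_norm
      filter_upwards [hopen.mem_nhds hy] with x hx
      exact cutoffField_eq_zero hε (le_of_lt hx)
    rw [hev.fderiv_eq, fderiv_const_apply, zero_apply, inner_zero_left]
    nlinarith [sq_nonneg ‖h‖]

/-- **Segment bound**: for a unit vector `n` and `t ≥ 0`, `⟪ζ_ε(a + t n) − ζ_ε(a), n⟫ ≥ −2D t`
(the function `θ ↦ ⟪ζ_ε(a + θ n), n⟫` has derivative `⟪Dζ_ε(·) n, n⟫ ≥ −2D`; mean value inequality). -/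
theorem inner_cutoffField_sub_ge {ε D : ℝ} (hε : 0 < ε) (hD0 : 0 ≤ D)
    (hD : ∀ t, |deriv Real.smoothTransition t| ≤ D) (a n : E) (hn : ‖n‖ = 1) {t : ℝ} (ht : 0 ≤ t) :
    -(2 * D) * t ≤ ⟪cutoffField ε (a + t • n) - cutoffField ε a, n⟫_ℝ := by
  set φ : ℝ → ℝ := fun θ => ⟪cutoffField ε (a + θ • n), n⟫_ℝ with hφ
  have hζ : Differentiable ℝ (cutoffField (E := E) ε) := (contDiff_cutoffField hε).differentiable one_ne_zero
  have hpath : ∀ θ : ℝ, HasDerivAt (fun θ : ℝ => a + θ • n) n θ := fun θ => by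
    simpa using ((hasDerivAt_id θ).smul_const n).const_add a
  have hderiv : ∀ θ : ℝ, HasDerivAt φ ⟪fderiv ℝ (cutoffField ε) (a + θ • n) n, n⟫_ℝ θ := by
    intro θ
    have h1 : HasDerivAt (fun θ : ℝ => cutoffField ε (a + θ • n))
        (fderiv ℝ (cutoffField ε) (a + θ • n) n) θ :=
      ((hζ (a + θ • n)).hasFDerivAt.comp_hasDerivAt θ (hpath θ) :)
    simpa using h1.inner ℝ (hasDerivAt_const θ n)
  have hdiff : Differentiable ℝ φ := fun θ => (hderiv θ).differentiableAt
  have hge : ∀ θ, -(2 * D) ≤ deriv φ θ := fun θ => by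
    rw [(hderiv θ).deriv]
    have h := inner_fderiv_cutoffField_ge hε hD0 hD (a + θ • n) n
    rwa [hn, one_pow, mul_one] at h
  have hmv := mul_sub_le_image_sub_of_le_deriv hdiff hge ht
  have h0 : φ 0 = ⟪cutoffField ε a, n⟫_ℝ := by simp [hφ]
  have ht' : φ t = ⟪cutoffField ε (a + t • n), n⟫_ℝ := rfl
  rw [inner_sub_left, ← h0, ← ht']
  linarith

/-! ## The registered helper statement -/

/-- **Cutoff-field toolkit** (helper statement of stub `stub_activityDomination`, line SketchK1): there is an
absolute constant `D ≥ 0` such that for every `ε > 0` the field `ζ_ε = cutoffField ε` on `ℝ³` is `C¹`, is the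
identity on the core `‖y‖ ≤ ε`, vanishes beyond `2ε`, has norm `≤ min ‖y‖ 2ε`, satisfies the quadratic-form bound
`⟪Dζ_ε(y)h, h⟫ ≥ −2D‖h‖²` and the segment bound `⟪ζ_ε(a + t n) − ζ_ε(a), n⟫ ≥ −2Dt` (`‖n‖ = 1`, `t ≥ 0`). -/
def CutoffFieldToolkit : Prop :=
  ∃ D : ℝ, 0 ≤ D ∧ ∀ ε : ℝ, 0 < ε →
    ContDiff ℝ 1 (cutoffField (E := EuclideanSpace ℝ (Fin 3)) ε) ∧
    (∀ y : EuclideanSpace ℝ (Fin 3), ‖y‖ ≤ ε → cutoffField ε y = y) ∧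
    (∀ y : EuclideanSpace ℝ (Fin 3), 2 * ε ≤ ‖y‖ → cutoffField ε y = 0) ∧
    (∀ y : EuclideanSpace ℝ (Fin 3), ‖cutoffField ε y‖ ≤ ‖y‖ ∧ ‖cutoffField ε y‖ ≤ 2 * ε) ∧
    (∀ y h : EuclideanSpace ℝ (Fin 3), -(2 * D) * ‖h‖ ^ 2 ≤ ⟪fderiv ℝ (cutoffField ε) y h, h⟫_ℝ) ∧
    (∀ (a n : EuclideanSpace ℝ (Fin 3)), ‖n‖ = 1 → ∀ t : ℝ, 0 ≤ t →
      -(2 * D) * t ≤ ⟪cutoffField ε (a + t • n) - cutoffField ε a, n⟫_ℝ)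

/-- The cutoff-field toolkit holds (registered helper `stub_cutoffFieldToolkit` of line SketchK1). -/
theorem stub_cutoffFieldToolkit : CutoffFieldToolkit := by
  obtain ⟨D, hD0, hD⟩ := Literature.Analysis.Calculus.exists_bound_deriv_smoothTransition
  refine ⟨D, hD0, fun ε hε => ⟨contDiff_cutoffField hε, fun y hy => cutoffField_eq_self hε hy,
    fun y hy => cutoffField_eq_zero hε hy,
    fun y => ⟨norm_cutoffField_le ε y, norm_cutoffField_le_two_mul hε y⟩,
    fun y h => inner_fderiv_cutoffField_ge hε hD0 hD y h,
    fun a n hn t ht => inner_cutoffField_sub_ge hε hD0 hD a n hn ht⟩⟩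

end Summit.AtomisticToContinuum.HydrodynamicLimit.Theorems.CollisionActivityTailsCutoff

end
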